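import Summits.QuantumFields.YangMills.Theorems.UnitScaleTiltProp7CurvedLandauCoreLinearSubspaceT3
import Summits.QuantumFields.YangMills.Theorems.UnitScaleTiltProp7DeltaEtaAlmostPositive
import Summits.QuantumFields.YangMills.Theorems.UnitScaleTiltProp7DivSliceOfMemberDivSq
import Summits.QuantumFields.YangMills.Theorems.UnitScaleTiltProp7SectET3CombLettersT3
import Summits.QuantumFields.YangMills.Theorems.UnitScaleTiltProp7RieszTauFrobNormT3
import Summits.QuantumFields.YangMills.Theorems.UnitScaleTiltProp7TwistedLevelMassOfRegPr
import HarnessLib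

/-!
# Route `UnitScaleTilt`, crux K1 «MinimiserStabilityRegPr» (stmt-QuantumFields-19200), LANE II «DIVERGENCE RECOVERY AT CURVED `W`» (★★OWNER RULING №23), brick (B4★):
# **THE ENGINE ROW (ENG) = ✓p702330's `hEng` FOLLOWS BY NAME FROM route-R's CURVED LINEAR CORE, MODULO ONE DISPLAYED ROW (QB) «TRUE AVERAGE ≤ TWISTED AVERAGE + LEGS»**

Cell `ym3-torus`, width seat `ym3-torus-px19` (gen 6; pen (B4★) per ★★OWNER RULING №23 (c) ∕ ★p1 g19 NAMER WORDS №1∕№5; LOCATE v2 `LOCATE-v2-ENG-byname-px19g6.md` b76552068b054f4d).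
THEOREMS ONLY (0 `def`, 0 `sorry`); `--supports stmt-QuantumFields-19200 --as helper`, count-neutral.  YM₃ on T³ is a ladder rung (R3), not d = 4, not infinite volume, not the
Clay problem; nothing here claims the stub, the crux, `hN06` or the mass gap.  CONDITIONAL: the row (QB) is DISPLAYED, not proved.

THE POINT.  ✓p702330 `Prop7HcoOfDivRecovery.hCo_of_divRecovery` turns (ENG) ∧ (REC) into the N06 coercivity row `hCo`.  (ENG) is the covariant Poincaré inequality
`γE‖y‖² ≤ re⟪y,Δ^η_W y⟫ + κD‖D*_W y‖² + κQ·aQ‖Qkc W y‖² + θE·e‖y‖²` with the TWISTED COMB average `Qkc` as the mean.  The TREE already holds the same inequality with the TRUE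
(symmetric, legs-included) linearised average `Q^{E′}_{K−n}` as the mean, K- and volume-uniformly: ✓`Prop7CurvedLandauCoreLinearSubspaceT3.linearised_subspace_core_budget_T3`
(★routeR-w3, over ✓`Prop7CurvedLandauCoreFinalT3`, the S2′ knit, the (R-A)∕(R-B)∕(R-C) curved-N6 chain of ★routeR-w2 — families instantiated, only `Q` displayed):
`((1∕2)ℓ⁻² − Aδ)Σ‖Y‖² − A·Z − 96ℓ⁻¹·Z_Q ≤ A·CURL_HS(Y)`, `A = 18 + 76800L⁴`, for every divergence budget `(δ, Z)` and true-average budget `Σ_ĉ‖Q (K−n) Y ĉ‖² ≤ Z_Q`.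
THIS FILE: take `δ := 0`, `Z := DIV_HS(Y)`, and `Z_Q :=` the displayed row (QB) «`Σ_ĉ‖Q^{E′}_{K−n}A ĉ‖² ≤ 2·Σ_c‖QTw W A c‖_F² + Cq·ℓ·(CURL_HS + DIV_HS)(A) + Cq′·e·ℓ⁻¹·Σ_b‖A b‖²`»
(content located in LOCATE v2: ✓`Prop7LegLemmaQTw.QTw_apply_eq_trueLinIter_sub_coarseGauge_T3` `QTw = Q^{E′} − D_Ū∘r` ⊕ the CORNER-frame legs row (R-LEGS) ⊕ the central-direction letters),
then read the three forms in the slot letters by the tree's dictionaries — CURL: ✓`Prop7DeltaEtaAlmostPositive.re_inner_DeltaEta_toL2_eq` + ✓`sum_trace_conjTranspose_mul_covCodiffCurlT_eq_sum_sq`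
+ ✓`Prop7DeltaPrimeL2Bound.norm_sum_trace_conjTranspose_mul_deltaPrimeOp_le` (the `D¹*D¹` part IS `c₀ℓ²·CURL_HS`, the `Δ′` part is `≥ −1029e‖y‖²`); DIV: ✓`Prop7DivSliceOfMemberDivSq.norm_sq_DstarL2_toL2_eq`
(`‖D*_W y‖² = c₀ℓ²·DIV_HS`); AVG: ✓`Prop7SectET3CombLetters.Qkc_toL2` + ✓`inner_toL2B` (`aQ‖Qkc W (toL2 A)‖² = a₀c₀ℓ·Σ_c‖QTw W A c‖_F²`).  RESULT: (ENG) VERBATIM with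
`γE := (4(A + 96Cq))⁻¹`, `κD := 1`, `κQ := 384∕(a₀·2(A + 96Cq))`, `θE := 1029 + 192Cq′∕(2(A+96Cq))`, `eE := min(eq, (2·10¹³L⁹)⁻¹)` — L-only.

WHAT IS PROVED (ns `…Theorems.Prop7EngOfTrueAvgBudget`):
* §1 letters: `norm_toL2B_sq` (`‖toL2B B‖² = cB·Σ_c‖B c‖_F²`), `aQ_normSq_Qkc_toL2_eq` (the AVG dictionary), `curlHS_le_re_inner_DeltaEtaSlot` (the CURL dictionary as an inequality),
  `sum_normSq_le_normSq_toL2` ∕ `normSq_toL2_le_two_mul` (operator vs Frobenius bond masses).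
* §2 ★★★ `hEng_of_trueAvgBudget (ha₀) (hQB) : <✓p702330's hEng = SKELETON v1.2 :94 VERBATIM>`.
HONEST SCOPE.  A by-name knit; the analytic content of (B4★) is the row (QB), OPEN (pens: the (R-LEGS) brick and the central letters, px19 lineage; the Λ-legs are ✓ by the (R-B) chain).
The killed (B4♭) is NOT used anywhere.  Nothing of [Balaban1985BackgroundPropagators] §3 is asserted beyond what the cited tree theorems prove.

References: T. Bałaban, CMP 99 (1985) 389–434 [Balaban1985BackgroundPropagators] ((3.10)–(3.15) pp.392–393, (3.26) p.395, Thm 3.11 p.416); CMP 102 (1985) 277–309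
[Balaban1985Variational] ((14) p.280, (44) p.285, Prop. 7 p.299); CMP 98 (1985) 17–51 [Balaban1985Averaging] ((89)–(92) p.31, (124)–(127) pp.36–37).
-/

set_option autoImplicit false

noncomputable section

open scoped BigOperators Matrix.Norms.L2Operator Matrix InnerProductSpace ComplexConjugate

namespace Summit.QuantumFields.YangMills.Theorems.Prop7EngOfTrueAvgBudget

open Literature.MathematicalPhysics.QuantumFieldTheory.Balaban1983to89
open Literature.MathematicalPhysics.QuantumFieldTheory.Balaban1983to89.T3ContinuumYM3Torus
open Literature.MathematicalPhysics.QuantumFieldTheory.Balaban1983to89.T3PrintedRegularMinimiser (RegPr)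
open Finset T4Continuum T4ReflectionCone BlockAveraging AveragingRT ExpMeanLog BlockAveragingEMLLinearised BlockAveragingEMLLinearisedBackground
  BlockAveragingEMLProp2 B1RG242Torus
open T3SectALandauChart (formComp bgUnits covCodiffCurlT eta eta_pos)
open B9Eq39Adjoint (curl divB posPlaq sum_posPlaq)
open B9Eq310Hermitian (deltaPrimeOp)
open B10Eq27TorusAxialLog (unitsField toUField)
open B9TorusCalculus (torusT)
open B9Eq311L2Pairing (WL2)
open B11Eq103H1Complex (BondL2K)
open Summit.QuantumFields.YangMills.Theorems.Prop7SectET3Transport (periodsT3)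
open Summit.QuantumFields.YangMills.Theorems.Prop7SectET3HilbertLetters (W₂ frobEquiv toL2 toL2B DstarL2 inner_toL2 inner_toL2B inner_frobEquiv_symm)
open Summit.QuantumFields.YangMills.Theorems.Prop7SectET3WilsonHessian (DeltaEta DeltaEtaSlot DeltaEtaSlot_apply)
open Summit.QuantumFields.YangMills.Theorems.Prop7SectET3CombLetters (Qkc Qkc_toL2)
open Summit.QuantumFields.YangMills.Theorems.Prop7SymAvgTw (QTw)
open Summit.QuantumFields.YangMills.Theorems.Prop7DeltaEtaAlmostPositive (re_inner_DeltaEta_toL2_eq norm_toL2_sq sum_trace_conjTranspose_mul_covCodiffCurlT_eq_sum_sq)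
open Summit.QuantumFields.YangMills.Theorems.Prop7DeltaPrimeL2Bound (norm_sum_trace_conjTranspose_mul_deltaPrimeOp_le)
open Summit.QuantumFields.YangMills.Theorems.Prop7DivSliceOfMemberDivSq (norm_sq_DstarL2_toL2_eq eta_sq_eq)
open Summit.QuantumFields.YangMills.Theorems.Prop7RieszTauFrobNorm (norm_sq_frobEquiv_symm norm_le_norm_frobEquiv_symm sum_norm_sq_le_two_mul_opNorm_sq)
open Summit.QuantumFields.YangMills.Theorems.Prop7TwistedLevelMassOfRegPr (plaq_le_of_regPr)
open Summit.QuantumFields.YangMills.Theorems.Prop7CurvedLandauCoreLinearSubspaceT3 (linearised_subspace_core_budget_T3)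
open Summit.QuantumFields.YangMills.Theorems.Prop7CurvedLandauRowA (exists_trueLinIter_family)
open Summit.QuantumFields.YangMills.Theorems.Prop7CurvedLandauKnitT3 (three_le_L)

/-! ## §1 Letters: the three dictionaries between the slot letters and route-R's lattice currencies -/

section Letters

variable {F : T3Family} {n K : ℕ}

/-- `‖toL2B B‖² = cB·Σ_c ‖B c‖_F²` (Frobenius entries; twin of ✓`norm_toL2_sq`). [cite: Balaban1985BackgroundPropagators, (3.11) p.392] -/
theorem norm_toL2B_sq {cB : ℝ} [Fact (0 < cB)] (B : PBond (F.P n) 0 → Matrix (Fin 2) (Fin 2) ℂ) :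
    ‖toL2B F n cB B‖ ^ 2 = cB * ∑ c : PBond (F.P n) 0, ‖(frobEquiv.symm (B c) : W₂)‖ ^ 2 := by
  have h2 : ∀ c : PBond (F.P n) 0, Matrix.trace ((B c).conjTranspose * B c) = (((‖(frobEquiv.symm (B c) : W₂)‖ ^ 2 : ℝ)) : ℂ) := by
    intro c
    rw [← inner_frobEquiv_symm, inner_self_eq_norm_sq_to_K]
    norm_cast
  rw [@norm_sq_eq_re_inner ℂ, inner_toL2B]
  simp_rw [h2]
  rw [← Complex.ofReal_sum, ← Complex.ofReal_mul, RCLike.re_to_complex, Complex.ofReal_re]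

/-- **THE AVG DICTIONARY**: `aQ·‖Qkc W (toL2 A)‖² = a₀·c₀·ℓ·Σ_c ‖QTw W A c‖_F²` with `aQ = a₀(c₀∕cB)ℓ³` (`Qkc = η•toL2B∘QTw∘toL2⁻¹`, `η²ℓ² = 1`).
[cite: Balaban1985Variational, (44) p.285; Balaban1985BackgroundPropagators, (3.14) p.393] -/
theorem aQ_normSq_Qkc_toL2_eq (h : n ≤ K) {c₀ cB : ℝ} [Fact (0 < c₀)] [Fact (0 < cB)] (a₀ : ℝ)
    (W : GaugeField (F.P K) 0 (Matrix.specialUnitaryGroup (Fin 2) ℂ)) (A : PBond (F.P K) 0 → Matrix (Fin 2) (Fin 2) ℂ) :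
    (a₀ * (c₀ / cB) * ((F.L : ℝ) ^ (K - n)) ^ 3) * ‖Qkc F n K h c₀ cB W (toL2 F K c₀ A)‖ ^ 2
      = a₀ * c₀ * (F.L : ℝ) ^ (K - n) * ∑ c : PBond (F.P n) 0, ‖(frobEquiv.symm (QTw F n K h W A c) : W₂)‖ ^ 2 := by
  have hcB : 0 < cB := Fact.out
  have hη : 0 < eta F n K := eta_pos F n K
  rw [Qkc_toL2, norm_smul, mul_pow, norm_toL2B_sq]
  have hn : ‖((eta F n K : ℝ) : ℂ)‖ = eta F n K := by
    rw [Complex.norm_real, Real.norm_eq_abs, abs_of_pos hη]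
  rw [hn, eta_sq_eq]
  have hL : (0 : ℝ) < (F.L : ℝ) ^ (K - n) := by
    have : (0 : ℝ) < F.L := by have := F.hL.2; exact_mod_cast (by omega : 0 < F.L)
    positivity
  field_simp

/-- **`Σ_b ‖A b‖² ≤ Σ_b ‖A b‖_F²` and `Σ_b ‖A b‖_F² ≤ 2·Σ_b ‖A b‖²`** (operator vs Frobenius norm of a `2×2` matrix). [cite: Balaban1985Averaging, (18)–(20) p.21] -/
theorem sum_normSq_le_sum_frob (A : PBond (F.P K) 0 → Matrix (Fin 2) (Fin 2) ℂ) :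
    ∑ b : PBond (F.P K) 0, ‖A b‖ ^ 2 ≤ ∑ b : PBond (F.P K) 0, ‖(frobEquiv.symm (A b) : W₂)‖ ^ 2 :=
  Finset.sum_le_sum fun b _ => pow_le_pow_left₀ (norm_nonneg _) (norm_le_norm_frobEquiv_symm (A b)) 2

/-- `Σ_b ‖A b‖_F² ≤ 2·Σ_b ‖A b‖²`. [cite: Balaban1985Averaging, (18)–(20) p.21] -/
theorem sum_frob_le_two_mul_sum_normSq (A : PBond (F.P K) 0 → Matrix (Fin 2) (Fin 2) ℂ) :
    ∑ b : PBond (F.P K) 0, ‖(frobEquiv.symm (A b) : W₂)‖ ^ 2 ≤ 2 * ∑ b : PBond (F.P K) 0, ‖A b‖ ^ 2 := by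
  rw [Finset.mul_sum]
  refine Finset.sum_le_sum fun b _ => ?_
  rw [norm_sq_frobEquiv_symm]
  exact sum_norm_sq_le_two_mul_opNorm_sq (A b)

set_option maxHeartbeats 400000 in
-- HEARTBEAT rule (README): the (3.10) dictionary rewrites a five-fold plaquette sum under `sum_posPlaq`; measured > 100k, budget kept decl-local.
/-- **THE CURL DICTIONARY (as an inequality)**: on `RegPr F n K e W`,
`c₀·ℓ²·CURL_HS(A) ≤ re⟪toL2 A, Δ^η_W (toL2 A)⟫ + 1029·e·‖toL2 A‖²`, `CURL_HS` in the engine's `curl (torusT) (unitsField (toUField W))` Hilbert–Schmidt letters.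
[cite: Balaban1985BackgroundPropagators, (3.10) p.392, (3.69) p.404; Balaban1985Variational, (14) p.280] -/
theorem curlHS_le_re_inner_DeltaEtaSlot {c₀ : ℝ} [Fact (0 < c₀)] {e : ℝ} (he : 0 ≤ e)
    (W : GaugeField (F.P K) 0 (Matrix.specialUnitaryGroup (Fin 2) ℂ)) (hreg : RegPr F n K e W) (A : PBond (F.P K) 0 → Matrix (Fin 2) (Fin 2) ℂ) :
    c₀ * ((F.L : ℝ) ^ (K - n)) ^ 2 * (∑ x : Site (F.P K) 0, ∑ μ : Fin (F.P K).d, ∑ ν : Fin (F.P K).d,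
            (if μ < ν then ∑ j : Fin 2, ∑ k : Fin 2,
              ‖(curl (torusT (F.P K) 0) (fun κ z => unitsField (toUField W) ⟨z, κ⟩) (fun κ z => A ⟨z, κ⟩) μ ν x) j k‖ ^ 2 else 0))
      ≤ RCLike.re ⟪toL2 F K c₀ A, DeltaEtaSlot F n K c₀ W (toL2 F K c₀ A)⟫_ℂ + 1029 * e * ‖toL2 F K c₀ A‖ ^ 2 := by
  have hc₀ : 0 < c₀ := Fact.out
  have hη : 0 < eta F n K := eta_pos F n K
  -- the curl sum in the `posPlaq`∕Frobenius form of the dictionary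
  have hP : (∑ q ∈ posPlaq (Site (F.P K) 0) (Fin (F.P K).d),
          ‖(frobEquiv.symm (curl (torusT (F.P K) 0) (fun μ x => bgUnits F K W ⟨x, μ⟩) (formComp A) q.2.1 q.2.2 q.1) : W₂)‖ ^ 2)
      = (∑ x : Site (F.P K) 0, ∑ μ : Fin (F.P K).d, ∑ ν : Fin (F.P K).d,
            (if μ < ν then ∑ j : Fin 2, ∑ k : Fin 2,
              ‖(curl (torusT (F.P K) 0) (fun κ z => unitsField (toUField W) ⟨z, κ⟩) (fun κ z => A ⟨z, κ⟩) μ ν x) j k‖ ^ 2 else 0)) := by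
    rw [sum_posPlaq (fun (x : Site (F.P K) 0) (μ ν : Fin (F.P K).d) =>
      ‖(frobEquiv.symm (curl (torusT (F.P K) 0) (fun μ x => bgUnits F K W ⟨x, μ⟩) (formComp A) μ ν x) : W₂)‖ ^ 2)]
    refine Finset.sum_congr rfl fun x _ => Finset.sum_congr rfl fun μ _ => Finset.sum_congr rfl fun ν _ => ?_
    split_ifs
    · rw [norm_sq_frobEquiv_symm]
      rfl
    · rfl
  rw [DeltaEtaSlot_apply, re_inner_DeltaEta_toL2_eq, norm_toL2_sq, sum_trace_conjTranspose_mul_covCodiffCurlT_eq_sum_sq, Complex.ofReal_re, hP]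
  set CURL := (∑ x : Site (F.P K) 0, ∑ μ : Fin (F.P K).d, ∑ ν : Fin (F.P K).d,
            (if μ < ν then ∑ j : Fin 2, ∑ k : Fin 2,
              ‖(curl (torusT (F.P K) 0) (fun κ z => unitsField (toUField W) ⟨z, κ⟩) (fun κ z => A ⟨z, κ⟩) μ ν x) j k‖ ^ 2 else 0)) with hCURL
  set SF : ℝ := ∑ b : PBond (F.P K) 0, ‖(frobEquiv.symm (A b) : W₂)‖ ^ 2 with hSF
  have hD := norm_sum_trace_conjTranspose_mul_deltaPrimeOp_le he W hreg A
  have hDre : -(1029 * (e * eta F n K ^ 2) * SF)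
      ≤ (∑ b : PBond (F.P K) 0, Matrix.trace ((A b).conjTranspose
          * deltaPrimeOp (torusT (F.P K) 0) (fun μ x => bgUnits F K W ⟨x, μ⟩) 1 (formComp A) b.dir b.src)).re := by
    have h2 := Complex.abs_re_le_norm (∑ b : PBond (F.P K) 0, Matrix.trace ((A b).conjTranspose
      * deltaPrimeOp (torusT (F.P K) 0) (fun μ x => bgUnits F K W ⟨x, μ⟩) 1 (formComp A) b.dir b.src))
    exact neg_le_of_abs_le (h2.trans hD)
  have hηinv : (eta F n K)⁻¹ ^ 2 = ((F.L : ℝ) ^ (K - n)) ^ 2 := Prop7DivSliceOfMemberDivSq.inv_eta_sq_eq F n K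
  have hℓη : ((F.L : ℝ) ^ (K - n)) ^ 2 * eta F n K ^ 2 = 1 := by
    rw [← hηinv, ← mul_pow, inv_mul_cancel₀ hη.ne', one_pow]
  rw [hηinv]
  have hk : 0 ≤ c₀ * ((F.L : ℝ) ^ (K - n)) ^ 2 := by positivity
  have h1 := mul_le_mul_of_nonneg_left hDre hk
  have h2 : c₀ * ((F.L : ℝ) ^ (K - n)) ^ 2 * (-(1029 * (e * eta F n K ^ 2) * SF)) = -(1029 * e * (c₀ * SF)) := by
    have : c₀ * ((F.L : ℝ) ^ (K - n)) ^ 2 * (-(1029 * (e * eta F n K ^ 2) * SF))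
        = -(1029 * e * (c₀ * SF) * (((F.L : ℝ) ^ (K - n)) ^ 2 * eta F n K ^ 2)) := by ring
    rw [this, hℓη, mul_one]
  rw [h2] at h1
  have h3 : c₀ * ((F.L : ℝ) ^ (K - n)) ^ 2 * (CURL + (∑ b : PBond (F.P K) 0, Matrix.trace ((A b).conjTranspose
          * deltaPrimeOp (torusT (F.P K) 0) (fun μ x => bgUnits F K W ⟨x, μ⟩) 1 (formComp A) b.dir b.src)).re)
      = c₀ * ((F.L : ℝ) ^ (K - n)) ^ 2 * CURL + c₀ * ((F.L : ℝ) ^ (K - n)) ^ 2 * (∑ b : PBond (F.P K) 0, Matrix.trace ((A b).conjTranspose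
          * deltaPrimeOp (torusT (F.P K) 0) (fun μ x => bgUnits F K W ⟨x, μ⟩) 1 (formComp A) b.dir b.src)).re := by ring
  rw [h3]
  linarith [h1]

end Letters

/-! ## §2 ★★★ (ENG) from the curved linear core + the displayed row (QB) -/

set_option maxHeartbeats 400000 in
-- HEARTBEAT rule (README): the displayed (QB)∕hQs binder text is ~40 lines; elaboration of the statement + the by-name core instantiation measured > 100k; decl-local.
/-- ★★★ **(B4★) = (ENG) MODULO (QB).**  DISPLAYED: (QB) «TRUE AVERAGE ≤ TWISTED AVERAGE + LEGS», c2 shape — per `L`, L-only `Cq Cq′ ≥ 0` and a radius `eq > 0` such that for every member,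
`n < K`, `0 < e ≤ eq`, `W ∈ RegPr F n K e`, the E′ recursion family `Q` (displayed recursion, zero content: ✓`Prop7CurvedLandauRowA.exists_trueLinIter_family`) and EVERY `M₂`-valued
`A`: `Σ_ĉ ‖Q (K−n) A ĉ‖² ≤ 2·Σ_c ‖QTw W A c‖_F² + Cq·ℓ·(CURL_HS(A) + DIV_HS(A)) + Cq′·e·ℓ⁻¹·Σ_b‖A b‖²` (content: ✓`Prop7LegLemmaQTw` leg identity ⊕ the corner-frame legs row
(R-LEGS) ⊕ the central-direction letters — LOCATE v2 b7655206).  CONCLUSION: ✓p702330's `hEng` (= SKELETON v1.2 :94) TOKEN FOR TOKEN, with `γE = (4(A+96Cq))⁻¹`, `κD = 1`,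
`κQ = 192∕(a₀(A+96Cq))`, `θE = 1029 + 96Cq′∕(A+96Cq)`, `eE = min(eq, (2·10¹³L⁹)⁻¹)`, `A = 18 + 76800L⁴` — by ✓`linearised_subspace_core_budget_T3` at `δ := 0`, `Z := DIV_HS`,
`Z_Q :=` (QB)'s right side, and the §1 dictionaries.  CONDITIONAL on (QB); nothing of (REC)∕hN06 is claimed.
[cite: Balaban1985BackgroundPropagators, Thm 3.11 p.416, (3.10)–(3.15) pp.392–393, (3.26) p.395; Balaban1985Variational, (14) p.280, (44) p.285] -/
theorem hEng_of_trueAvgBudget (c₀ cB a₀ : ℕ → ℝ) [hc₀ : ∀ L : ℕ, Fact (0 < c₀ L)] [hcB : ∀ L : ℕ, Fact (0 < cB L)]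
    (ha₀ : ∀ L : ℕ, 1 < L → 0 < a₀ L)
    (hQB : ∀ (L : ℕ), 1 < L → ∃ Cq Cq' eq : ℝ, 0 ≤ Cq ∧ 0 ≤ Cq' ∧ 0 < eq ∧
      ∀ (F : T3Family), F.L = L → ∀ (n K : ℕ) (hnK : n < K) (e : ℝ) (W : GaugeField (F.P K) 0 (Matrix.specialUnitaryGroup (Fin 2) ℂ)),
        0 < e → e ≤ eq → RegPr F n K e W →
        ∀ (Q : (k : ℕ) → (PBond (F.P K) 0 → Matrix (Fin 2) (Fin 2) ℂ) → PBond (F.P K) k → Matrix (Fin 2) (Fin 2) ℂ), (∀ Y, Q 0 Y = Y) →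
        (∀ (k : ℕ) (Y : PBond (F.P K) 0 → Matrix (Fin 2) (Fin 2) ℂ) (c : PBond (F.P K) (k + 1)), Q (k + 1) Y c
          = (fderiv ℂ (eml : (Idx (F.P K) → Matrix (Fin 2) (Fin 2) ℂ) → Matrix (Fin 2) (Fin 2) ℂ)
                (fun i => ((loopHol (Averaging.iter (fun i => blockAvg (P := (F.P K)) (j := i) (expMeanLogSU (n := Fin 2))) k W) c i : Matrix.specialUnitaryGroup (Fin 2) ℂ) : Matrix (Fin 2) (Fin 2) ℂ))
                (fun i => covWalkSum (Averaging.iter (fun i => blockAvg (P := (F.P K)) (j := i) (expMeanLogSU (n := Fin 2))) k W) (Q k Y) (walk (emb c.src) (loopWord (F.P K).L c.dir (off i.1) i.2.1 i.2.2))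
                  * ((loopHol (Averaging.iter (fun i => blockAvg (P := (F.P K)) (j := i) (expMeanLogSU (n := Fin 2))) k W) c i : Matrix.specialUnitaryGroup (Fin 2) ℂ) : Matrix (Fin 2) (Fin 2) ℂ))
                * star ((corr (expMeanLogSU (n := Fin 2)) (Averaging.iter (fun i => blockAvg (P := (F.P K)) (j := i) (expMeanLogSU (n := Fin 2))) k W) c : Matrix.specialUnitaryGroup (Fin 2) ℂ) : Matrix (Fin 2) (Fin 2) ℂ)
              + ((corr (expMeanLogSU (n := Fin 2)) (Averaging.iter (fun i => blockAvg (P := (F.P K)) (j := i) (expMeanLogSU (n := Fin 2))) k W) c : Matrix.specialUnitaryGroup (Fin 2) ℂ) : Matrix (Fin 2) (Fin 2) ℂ)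
                * covWalkSum (Averaging.iter (fun i => blockAvg (P := (F.P K)) (j := i) (expMeanLogSU (n := Fin 2))) k W) (Q k Y) (walk (emb c.src) (List.replicate (F.P K).L (c.dir, true)))
                * star ((corr (expMeanLogSU (n := Fin 2)) (Averaging.iter (fun i => blockAvg (P := (F.P K)) (j := i) (expMeanLogSU (n := Fin 2))) k W) c : Matrix.specialUnitaryGroup (Fin 2) ℂ) : Matrix (Fin 2) (Fin 2) ℂ))) →
        ∀ (A : PBond (F.P K) 0 → Matrix (Fin 2) (Fin 2) ℂ),
          ∑ c : PBond (F.P K) (K - n), ‖Q (K - n) A c‖ ^ 2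
            ≤ 2 * (∑ c : PBond (F.P n) 0, ‖(frobEquiv.symm (QTw F n K hnK.le W A c) : W₂)‖ ^ 2)
              + Cq * (F.L : ℝ) ^ (K - n) * ((∑ x : Site (F.P K) 0, ∑ μ : Fin (F.P K).d, ∑ ν : Fin (F.P K).d,
                    (if μ < ν then ∑ j : Fin 2, ∑ k : Fin 2,
                      ‖(curl (torusT (F.P K) 0) (fun κ z => unitsField (toUField W) ⟨z, κ⟩) (fun κ z => A ⟨z, κ⟩) μ ν x) j k‖ ^ 2 else 0))
                  + (∑ x : Site (F.P K) 0, ∑ j : Fin 2, ∑ k : Fin 2,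
                    ‖(divB (torusT (F.P K) 0) (fun κ z => unitsField (toUField W) ⟨z, κ⟩) (fun κ z => A ⟨z, κ⟩) x) j k‖ ^ 2))
              + Cq' * e * ((F.L : ℝ) ^ (K - n))⁻¹ * (∑ b : PBond (F.P K) 0, ‖A b‖ ^ 2)) :
    ∀ (L : ℕ), 1 < L → ∃ γE κD κQ θE eE : ℝ, 0 < γE ∧ 0 ≤ κD ∧ 0 ≤ κQ ∧ 0 ≤ θE ∧ 0 < eE ∧
      ∀ (F : T3Family), F.L = L → ∀ (n K : ℕ) (hnK : n < K) (e : ℝ) (W : GaugeField (F.P K) 0 (Matrix.specialUnitaryGroup (Fin 2) ℂ)),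
        0 < e → e ≤ eE → RegPr F n K e W →
        ∀ y : BondL2K ℂ 3 (periodsT3 F K) (c₀ F.L) W₂,
          γE * ‖y‖ ^ 2 ≤ RCLike.re ⟪y, DeltaEtaSlot F n K (c₀ F.L) W y⟫_ℂ + κD * ‖DstarL2 F n K (c₀ F.L) W y‖ ^ 2
            + κQ * ((a₀ F.L * (c₀ F.L / cB F.L) * ((F.L : ℝ) ^ (K - n)) ^ 3) * ‖Qkc F n K hnK.le (c₀ F.L) (cB F.L) W y‖ ^ 2) + θE * e * ‖y‖ ^ 2 := by
  intro L hL
  obtain ⟨Cq, Cq', eq, hCq, hCq', heq, hrow⟩ := hQB L hL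
  have ha := ha₀ L hL
  -- the constants
  set AL : ℝ := 18 + 76800 * (L : ℝ) ^ 4 with hAL
  have hL1 : (1 : ℝ) ≤ (L : ℝ) := by exact_mod_cast hL.le
  have hAL0 : 0 < AL := by positivity
  set M : ℝ := AL + 96 * Cq with hM
  have hM0 : 0 < M := by positivity
  set eC : ℝ := (20000000000000 * (L : ℝ) ^ 9)⁻¹ with heC
  have heC0 : 0 < eC := by positivity
  have hγ : 0 < (4 * M)⁻¹ := by positivity
  have hκQ : 0 ≤ 192 / (a₀ L * M) := div_nonneg (by norm_num) (mul_pos ha hM0).le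
  have hθ : 0 ≤ 1029 + 96 * Cq' / M := by
    have : 0 ≤ 96 * Cq' / M := div_nonneg (by positivity) hM0.le
    linarith
  refine ⟨(4 * M)⁻¹, 1, 192 / (a₀ L * M), 1029 + 96 * Cq' / M, min eq eC, hγ, zero_le_one, hκQ, hθ, lt_min heq heC0, ?_⟩
  intro F hF n K hnK e W he heE hreg y
  subst hF
  -- the member data
  have hLpos : (0 : ℝ) < (F.L : ℝ) := by linarith [three_le_L F]
  set ℓ : ℝ := (F.L : ℝ) ^ (K - n) with hℓ
  have hℓ0 : 0 < ℓ := pow_pos hLpos _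
  have hℓ1 : 1 ≤ ℓ := one_le_pow₀ (by linarith [three_le_L F])
  obtain ⟨A, rfl⟩ := (toL2 F K (c₀ F.L)).surjective y
  have hc₀ : 0 < c₀ F.L := (hc₀ F.L).out
  have hcB : 0 < cB F.L := (hcB F.L).out
  -- the (14)-type plaquette bound and the windows
  have heq' : e ≤ eq := heE.trans (min_le_left _ _)
  have heC' : e ≤ eC := heE.trans (min_le_right _ _)
  have hU : ∀ p : Plaq (F.P K) 0, dist1 (GaugeField.plaqHol W p) ≤ e * (((F.L : ℝ) ^ (K - n)) ^ 2)⁻¹ := plaq_le_of_regPr F n K hreg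
  have hεL : 20000000000000 * (F.L : ℝ) ^ 9 * e ≤ 1 := by
    have h9 : 0 < 20000000000000 * (F.L : ℝ) ^ 9 := by positivity
    calc 20000000000000 * (F.L : ℝ) ^ 9 * e ≤ 20000000000000 * (F.L : ℝ) ^ 9 * eC := mul_le_mul_of_nonneg_left heC' h9.le
      _ = 1 := by rw [heC]; field_simp
  -- the true linearised family and the row (QB)
  obtain ⟨Q, hQ0, hQs⟩ := exists_trueLinIter_family (N := 2) W
  have hZQ := hrow F rfl n K hnK e W he heq' hreg Q hQ0 hQs A
  -- abbreviations for the four lattice forms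
  set CURL := (∑ x : Site (F.P K) 0, ∑ μ : Fin (F.P K).d, ∑ ν : Fin (F.P K).d,
            (if μ < ν then ∑ j : Fin 2, ∑ k : Fin 2,
              ‖(curl (torusT (F.P K) 0) (fun κ z => unitsField (toUField W) ⟨z, κ⟩) (fun κ z => A ⟨z, κ⟩) μ ν x) j k‖ ^ 2 else 0)) with hCURL
  set DIV := (∑ x : Site (F.P K) 0, ∑ j : Fin 2, ∑ k : Fin 2,
            ‖(divB (torusT (F.P K) 0) (fun κ z => unitsField (toUField W) ⟨z, κ⟩) (fun κ z => A ⟨z, κ⟩) x) j k‖ ^ 2) with hDIV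
  set S := (∑ b : PBond (F.P K) 0, ‖A b‖ ^ 2) with hS
  set FQ := (∑ c : PBond (F.P n) 0, ‖(frobEquiv.symm (QTw F n K hnK.le W A c) : W₂)‖ ^ 2) with hFQ
  set SF := (∑ b : PBond (F.P K) 0, ‖(frobEquiv.symm (A b) : W₂)‖ ^ 2) with hSF
  have hCURL0 : 0 ≤ CURL := by
    refine Finset.sum_nonneg fun _ _ => Finset.sum_nonneg fun _ _ => Finset.sum_nonneg fun _ _ => ?_
    split_ifs
    · exact Finset.sum_nonneg fun _ _ => Finset.sum_nonneg fun _ _ => sq_nonneg _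
    · exact le_rfl
  have hDIV0 : 0 ≤ DIV := Finset.sum_nonneg fun _ _ => Finset.sum_nonneg fun _ _ => Finset.sum_nonneg fun _ _ => sq_nonneg _
  have hS0 : 0 ≤ S := Finset.sum_nonneg fun _ _ => sq_nonneg _
  have hFQ0 : 0 ≤ FQ := Finset.sum_nonneg fun _ _ => sq_nonneg _
  -- the curved linear core with `δ := 0`, `Z := DIV`, `Z_Q :=` the row
  have hdivB : DIV ≤ 0 * S + DIV := by rw [zero_mul, zero_add]
  have hcore := linearised_subspace_core_budget_T3 F n K W he hεL hU Q hQ0 hQs A hdivB hZQ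
  -- the dictionaries
  have hcurl := curlHS_le_re_inner_DeltaEtaSlot (c₀ := c₀ F.L) he.le W hreg A
  have hdiv : ‖DstarL2 F n K (c₀ F.L) W (toL2 F K (c₀ F.L) A)‖ ^ 2 = c₀ F.L * ℓ ^ 2 * DIV := norm_sq_DstarL2_toL2_eq F n K (c₀ F.L) W A
  have havg := aQ_normSq_Qkc_toL2_eq (F := F) hnK.le (c₀ := c₀ F.L) (cB := cB F.L) (a₀ F.L) W A
  have hy : ‖toL2 F K (c₀ F.L) A‖ ^ 2 = c₀ F.L * SF := norm_toL2_sq A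
  have hS_le : S ≤ SF := sum_normSq_le_sum_frob A
  have hSF_le : SF ≤ 2 * S := sum_frob_le_two_mul_sum_normSq A
  -- scalar assembly
  have hAL_F : (18 + 76800 * (F.L : ℝ) ^ 4) = AL := by rw [hAL]
  rw [hAL_F] at hcore
  -- `hcore : (1/2·ℓ⁻² − AL·0)·S − AL·DIV − 96·ℓ⁻¹·(2FQ + Cq·ℓ·(CURL+DIV) + Cq'·e·ℓ⁻¹·S) ≤ AL·CURL`
  have hℓinv : ℓ⁻¹ * ℓ = 1 := inv_mul_cancel₀ hℓ0.ne'
  have step1 : (1 / 2) * S ≤ ℓ ^ 2 * M * (CURL + DIV) + 192 * ℓ * FQ + 96 * Cq' * e * S := by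
    have h := mul_le_mul_of_nonneg_left hcore (sq_nonneg ℓ)
    have e1 : ℓ ^ 2 * (((1 / 2) * (ℓ ^ 2)⁻¹ - AL * 0) * S - AL * DIV - 96 * ℓ⁻¹ * (2 * FQ + Cq * ℓ * (CURL + DIV) + Cq' * e * ℓ⁻¹ * S))
        = (1 / 2) * S - ℓ ^ 2 * AL * DIV - 192 * ℓ * FQ - 96 * Cq * ℓ ^ 2 * (CURL + DIV) - 96 * Cq' * e * S := by
      field_simp
      ring
    have e2 : ℓ ^ 2 * (AL * CURL) = ℓ ^ 2 * AL * CURL := by ring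
    rw [e1, e2] at h
    have e3 : ℓ ^ 2 * M * (CURL + DIV) = ℓ ^ 2 * AL * CURL + ℓ ^ 2 * AL * DIV + 96 * Cq * ℓ ^ 2 * (CURL + DIV) := by rw [hM]; ring
    have e4 : 0 ≤ ℓ ^ 2 * AL * DIV := by positivity
    linarith [h, e3, e4]
  -- in the slot letters (multiply by `2c₀`)
  have step2 : c₀ F.L * S ≤ 2 * M * (c₀ F.L * ℓ ^ 2 * CURL + c₀ F.L * ℓ ^ 2 * DIV) + 384 * (c₀ F.L * ℓ * FQ) + 192 * Cq' * e * (c₀ F.L * S) := by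
    have h := mul_le_mul_of_nonneg_left step1 (by positivity : (0 : ℝ) ≤ 2 * c₀ F.L)
    have lhs : 2 * c₀ F.L * ((1 / 2) * S) = c₀ F.L * S := by ring
    have rhs : 2 * c₀ F.L * (ℓ ^ 2 * M * (CURL + DIV) + 192 * ℓ * FQ + 96 * Cq' * e * S)
        = 2 * M * (c₀ F.L * ℓ ^ 2 * CURL + c₀ F.L * ℓ ^ 2 * DIV) + 384 * (c₀ F.L * ℓ * FQ) + 192 * Cq' * e * (c₀ F.L * S) := by ring
    rw [lhs, rhs] at h
    exact h
  have hcurl' : c₀ F.L * ℓ ^ 2 * CURL ≤ RCLike.re ⟪toL2 F K (c₀ F.L) A, DeltaEtaSlot F n K (c₀ F.L) W (toL2 F K (c₀ F.L) A)⟫_ℂ + 1029 * e * ‖toL2 F K (c₀ F.L) A‖ ^ 2 := hcurl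
  have havg' : c₀ F.L * ℓ * FQ = (a₀ F.L)⁻¹ * ((a₀ F.L * (c₀ F.L / cB F.L) * ℓ ^ 3) * ‖Qkc F n K hnK.le (c₀ F.L) (cB F.L) W (toL2 F K (c₀ F.L) A)‖ ^ 2) := by
    rw [hℓ, hFQ, havg]; field_simp
  have hyS : ‖toL2 F K (c₀ F.L) A‖ ^ 2 ≤ 2 * (c₀ F.L * S) := by
    rw [hy]
    have := mul_le_mul_of_nonneg_left hSF_le hc₀.le
    linarith [this]
  have hSy : c₀ F.L * S ≤ ‖toL2 F K (c₀ F.L) A‖ ^ 2 := by rw [hy]; exact mul_le_mul_of_nonneg_left hS_le hc₀.le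
  -- final
  set RE := RCLike.re ⟪toL2 F K (c₀ F.L) A, DeltaEtaSlot F n K (c₀ F.L) W (toL2 F K (c₀ F.L) A)⟫_ℂ with hRE
  set DD := ‖DstarL2 F n K (c₀ F.L) W (toL2 F K (c₀ F.L) A)‖ ^ 2 with hDD
  set QQ := (a₀ F.L * (c₀ F.L / cB F.L) * ℓ ^ 3) * ‖Qkc F n K hnK.le (c₀ F.L) (cB F.L) W (toL2 F K (c₀ F.L) A)‖ ^ 2 with hQQ
  set YY := ‖toL2 F K (c₀ F.L) A‖ ^ 2 with hYY
  have hQQ0 : 0 ≤ QQ := by positivity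
  have hYY0 : 0 ≤ YY := by positivity
  have hDD' : c₀ F.L * ℓ ^ 2 * DIV = DD := hdiv.symm
  -- `c₀ S ≤ 2M·(RE + 1029 e YY + DD) + (384/a₀)·QQ + 192 Cq' e · c₀ S`, then `YY ≤ 2 c₀ S`
  have step3 : c₀ F.L * S ≤ 2 * M * (RE + 1029 * e * YY + DD) + 384 * (a₀ F.L)⁻¹ * QQ + 192 * Cq' * e * YY := by
    have h1 : c₀ F.L * ℓ ^ 2 * CURL + c₀ F.L * ℓ ^ 2 * DIV ≤ RE + 1029 * e * YY + DD := by rw [← hDD']; linarith [hcurl']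
    have h2 : 192 * Cq' * e * (c₀ F.L * S) ≤ 192 * Cq' * e * YY := by
      have : 0 ≤ 192 * Cq' * e := by positivity
      exact mul_le_mul_of_nonneg_left hSy this
    have h3 : 384 * (c₀ F.L * ℓ * FQ) = 384 * (a₀ F.L)⁻¹ * QQ := by rw [havg']; ring
    have h1' := mul_le_mul_of_nonneg_left h1 (by positivity : (0 : ℝ) ≤ 2 * M)
    linarith [step2, h1', h2, h3]
  -- divide by `2M` and use `YY ≤ 2 c₀ S`
  have step4 : (4 * M)⁻¹ * YY ≤ RE + 1 * DD + 192 / (a₀ F.L * M) * QQ + (1029 + 96 * Cq' / M) * e * YY := by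
    have hM2 : 0 < 2 * M := by positivity
    have h := div_le_div_of_nonneg_right step3 hM2.le
    have e1 : (4 * M)⁻¹ * YY ≤ c₀ F.L * S / (2 * M) := by
      rw [div_eq_mul_inv]
      have : (4 * M)⁻¹ * YY = (YY / 2) * (2 * M)⁻¹ := by field_simp; ring
      rw [this]
      exact mul_le_mul_of_nonneg_right (by linarith [hyS]) (inv_nonneg.mpr hM2.le)
    have e2 : (2 * M * (RE + 1029 * e * YY + DD) + 384 * (a₀ F.L)⁻¹ * QQ + 192 * Cq' * e * YY) / (2 * M)
        = RE + 1 * DD + 192 / (a₀ F.L * M) * QQ + (1029 + 96 * Cq' / M) * e * YY := by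
      field_simp
      ring
    rw [e2] at h
    exact e1.trans h
  simpa only [hRE, hDD, hQQ, hYY, hℓ] using step4

end Summit.QuantumFields.YangMills.Theorems.Prop7EngOfTrueAvgBudget

end
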